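import Mathlib
import HarnessLib
import Summits.NavierStokesRegularity.NavierStokesRegularity.Theorems.UnthreadedRigidityDoorUnthreadedRigidityHornPressureWindow
import Summits.NavierStokesRegularity.NavierStokesRegularity.Theorems.UnthreadedRigidityDoorUnthreadedRigidityPressureHornCompositions
import Summits.NavierStokesRegularity.NavierStokesRegularity.Theorems.UnthreadedRigidityDoorUnthreadedRigidityVirialHornWindowAxisUniform

/-!
# Route `UnthreadedRigidityDoor`, item `UnthreadedRigidity` (W2, stmt-NavierStokesRegularity-27585) — bookkeeping after bridge PH:
# the PRESSURE HORN rungs with PH / PH-W′ (and S-U) STRUCK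

Prover file (W2 Lean hand ns-crc-p1 g9, by lineage; `--supports stmt-NavierStokesRegularity-27585 --as helper`).  K2-p2 g13's PRESSURE HORN line
(`…PressureHornDefs`, `…PressureHornCompositions`) reduced its `l = 2`-ISOTYPIC rungs to bridges: slice rung I2
`isotypicOrderTwoRigidity_of_bridges : IsotypicOrderOneIdentity → NestedHornExclusion → HornIdentityTwo → IsotypicOrderTwoRigidity`, window rung W
`isotypicWindowRigidity_of_bridges : WindowWedgeAnalytic → HornWindowSilenceVar → WindowAxisUniform → IsotypicWindowRigidity`.  With
`hornIdentityTwo_holds` / `separableShellOrderTwoRigidity_holds` (`…HornPressureBracket`), `hornWindowSilenceVar_holds` (`…HornPressureWindow`) and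
crc-p2 g8's S-U `VirialHorn.windowAxisUniform_holds` (the PRESSURE HORN twin `PressureHorn.WindowAxisUniform` has the byte-identical body):

* `pressureHorn_windowAxisUniform_holds : PressureHorn.WindowAxisUniform`;
* ★ `isotypicWindowRigidity_of_wedge : PressureHorn.WindowWedgeAnalytic → PressureHorn.IsotypicWindowRigidity` — the isotypic `l = 2` WINDOW rung
  now waits on bridge W (window wedge law + analyticity, i.e. bracket injectivity in degree 2, KEY-NS #210) ALONE;
* `isotypicOrderTwoRigidity_of_identity_of_exclusion : IsotypicOrderOneIdentity → NestedHornExclusion → IsotypicOrderTwoRigidity` — slice rung I2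
  with PH struck (DP2 and the exclusion crux X remain).

This module imports `…PressureHornCompositions`, which imports the route file (theses cone, advisory).  HONEST LABEL: bookkeeping of RUNG lines about
SPECIAL isotypic `l = 2` data; `UnthreadedRigidity` (27585), W2 and NS regularity remain OPEN; no summit statement is proved here.  0 kit.
-/

-- the summit and its single sub-problem share the name (CONVENTIONS §1), as in every Theorems file
set_option linter.dupNamespace false

namespace Summit.NavierStokesRegularity.NavierStokesRegularity.Theorems.UnthreadedRigidity.HornPressure

open Summit.NavierStokesRegularity.NavierStokesRegularity.Theorems.UnthreadedRigidity.PressureHorn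
  (IsotypicOrderOneIdentity NestedHornExclusion IsotypicOrderTwoRigidity WindowWedgeAnalytic IsotypicWindowRigidity
   isotypicOrderTwoRigidity_of_horns isotypicWindowRigidity_of_bridges)

/-- S-U for the PRESSURE HORN twin (`PressureHorn.WindowAxisUniform`, byte-identical to `VirialHorn.WindowAxisUniform`, proved by crc-p2 g8). -/
theorem pressureHorn_windowAxisUniform_holds : PressureHorn.WindowAxisUniform :=
  VirialHorn.windowAxisUniform_holds

/-- ★ THE ISOTYPIC `l = 2` WINDOW RUNG OF THE PRESSURE HORN LINE WAITS ON BRIDGE W ALONE: `WindowWedgeAnalytic → IsotypicWindowRigidity`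
(PH-W′ = `hornWindowSilenceVar_holds`, S-U = `pressureHorn_windowAxisUniform_holds`). -/
theorem isotypicWindowRigidity_of_wedge (hWA : WindowWedgeAnalytic) : IsotypicWindowRigidity :=
  isotypicWindowRigidity_of_bridges hWA hornWindowSilenceVar_holds pressureHorn_windowAxisUniform_holds

/-- The isotypic `l = 2` SLICE rung of the PRESSURE HORN line with bridge PH struck: `IsotypicOrderOneIdentity → NestedHornExclusion →
IsotypicOrderTwoRigidity` (the separable rung inside is `separableShellOrderTwoRigidity_holds`). -/
theorem isotypicOrderTwoRigidity_of_identity_of_exclusion (hM : IsotypicOrderOneIdentity) (hX : NestedHornExclusion) :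
    IsotypicOrderTwoRigidity :=
  isotypicOrderTwoRigidity_of_horns hM hX separableShellOrderTwoRigidity_holds

end Summit.NavierStokesRegularity.NavierStokesRegularity.Theorems.UnthreadedRigidity.HornPressure
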